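import Summits.Ventures.DiscreteObjects.PP12.FanoFiveECodeWords

/-!
# PP(12), order 5: bit permutations fixing `{5, 6}` act on word codes (kernel; the residual symmetry a kernel certificate may quotient by)
Framing: lottery ticket; floor = certified bounds/negative ranges.

Cell pub-namedobj (venture DiscreteObjects), target (M), designs gen 17. `FanoFive.IsWordCode` (`FanoFiveECodeWords`) is preserved by permuting the seven bit
positions with a permutation `π` that fixes or swaps the positions `5, 6` (so that the normalized words `95 = all-but-5` and `63 = all-but-6` are preserved as a
pair): `permWord`, **`IsWordCode.perm`**. This is the residual symmetry `S₅ × S₂` of the normal form; designs g17's sizing of a kernel certificate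
(code/cert/README.md, results/ecode_orbits.txt) quotients the `2655` admissible weight-2 quadruples by it (`34` orbits, `≈ 8·10⁵` DFS nodes in total).
A certificate then needs only: this lemma, a covering table of the quadruples by orbit representatives (decidable), and the per-representative refutations.
Nothing here asserts any census statement. No `sorry`, no new axioms.
-/

namespace Summit.Ventures.DiscreteObjects.PP12

open Finset

namespace FanoFive

/-- permute the seven low bits: bit `x` of the new word is bit `π x` of the old one -/
def permWord (π : Equiv.Perm (Fin 7)) (w : ℕ) : ℕ := Nat.ofBits fun x : Fin 7 => w.testBit (π x)

/-- bits of a permuted word -/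
theorem testBit_permWord (π : Equiv.Perm (Fin 7)) (w : ℕ) (x : Fin 7) : (permWord π w).testBit x = w.testBit (π x) := by
  unfold permWord
  rw [Nat.testBit_ofBits_lt _ _ x.isLt]

/-- high bits of a permuted word vanish -/
theorem testBit_permWord_ge (π : Equiv.Perm (Fin 7)) (w : ℕ) {i : ℕ} (hi : 7 ≤ i) : (permWord π w).testBit i = false := by
  unfold permWord
  exact Nat.testBit_ofBits_ge _ _ hi

/-- a permuted word is a 7-bit word -/
theorem permWord_lt (π : Equiv.Perm (Fin 7)) (w : ℕ) : permWord π w < 128 := Nat.ofBits_lt_two_pow _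

/-- high bits of a 7-bit word vanish -/
theorem testBit_ge_of_lt {w : ℕ} (hw : w < 128) {i : ℕ} (hi : 7 ≤ i) : w.testBit i = false := by
  have h1 : w < 2 ^ 7 := by simpa using hw
  have h2 : 2 ^ 7 ≤ 2 ^ i := Nat.pow_le_pow_right (by norm_num) hi
  exact Nat.testBit_lt_two_pow (lt_of_lt_of_le h1 h2)

/-- `permWord π` is injective on 7-bit words -/
theorem permWord_inj (π : Equiv.Perm (Fin 7)) {v w : ℕ} (hv : v < 128) (hw : w < 128) (h : permWord π v = permWord π w) : v = w := by
  apply Nat.eq_of_testBit_eq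
  intro i
  by_cases hi : i < 7
  · have e := congrArg (fun u => Nat.testBit u (π.symm ⟨i, hi⟩)) h
    simp only [testBit_permWord, Equiv.apply_symm_apply] at e
    exact e
  · push Not at hi
    rw [testBit_ge_of_lt hv hi, testBit_ge_of_lt hw hi]

/-- Hamming distance is invariant -/
theorem hdist_permWord (π : Equiv.Perm (Fin 7)) (v w : ℕ) : hdist (permWord π v) (permWord π w) = hdist v w := by
  unfold hdist
  simp only [testBit_permWord]
  exact card_filter_perm π (fun y => v.testBit y ≠ w.testBit y)

/-- the zero word is fixed -/
theorem permWord_zero (π : Equiv.Perm (Fin 7)) : permWord π 0 = 0 := by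
  apply Nat.eq_of_testBit_eq
  intro i
  by_cases hi : i < 7
  · have := testBit_permWord π 0 ⟨i, hi⟩
    simp only [Nat.zero_testBit] at this ⊢
    exact this
  · push Not at hi
    rw [testBit_permWord_ge π 0 hi, Nat.zero_testBit]

/-- bits of `95` and `63` -/
theorem testBit_95_63 : ∀ x : Fin 7, (Nat.testBit 95 x = decide (x ≠ 5)) ∧ (Nat.testBit 63 x = decide (x ≠ 6)) := by decide

/-- a word all of whose low bits but one (`a`) are set is `95` if `a = 5`, `63` if `a = 6` -/
theorem eq_of_testBit_ne {u : ℕ} (hu : u < 128) {a : Fin 7} (h : ∀ x : Fin 7, u.testBit x = decide (x ≠ a)) :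
    (a = 5 → u = 95) ∧ (a = 6 → u = 63) := by
  constructor
  · rintro rfl
    apply Nat.eq_of_testBit_eq
    intro i
    by_cases hi : i < 7
    · rw [h ⟨i, hi⟩, (testBit_95_63 ⟨i, hi⟩).1]
    · push Not at hi
      rw [testBit_ge_of_lt hu hi, testBit_ge_of_lt (by norm_num) hi]
  · rintro rfl
    apply Nat.eq_of_testBit_eq
    intro i
    by_cases hi : i < 7
    · rw [h ⟨i, hi⟩, (testBit_95_63 ⟨i, hi⟩).2]
    · push Not at hi
      rw [testBit_ge_of_lt hu hi, testBit_ge_of_lt (by norm_num) hi]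

/-- the pair `{95, 63}` is preserved by a permutation fixing or swapping the positions `5, 6` -/
theorem permWord_95_63 (π : Equiv.Perm (Fin 7)) (h56 : (π 5 = 5 ∧ π 6 = 6) ∨ (π 5 = 6 ∧ π 6 = 5)) :
    (permWord π 95 = 95 ∧ permWord π 63 = 63) ∨ (permWord π 95 = 63 ∧ permWord π 63 = 95) := by
  have b95 : ∀ x : Fin 7, (permWord π 95).testBit x = decide (x ≠ π.symm 5) := fun x => by
    rw [testBit_permWord, (testBit_95_63 (π x)).1]
    congr 1; simp only [ne_eq, eq_iff_iff]; rw [Equiv.eq_symm_apply]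
  have b63 : ∀ x : Fin 7, (permWord π 63).testBit x = decide (x ≠ π.symm 6) := fun x => by
    rw [testBit_permWord, (testBit_95_63 (π x)).2]
    congr 1; simp only [ne_eq, eq_iff_iff]; rw [Equiv.eq_symm_apply]
  rcases h56 with ⟨h5, h6⟩ | ⟨h5, h6⟩
  · left
    have s5 : π.symm 5 = 5 := by rw [Equiv.symm_apply_eq]; exact h5.symm
    have s6 : π.symm 6 = 6 := by rw [Equiv.symm_apply_eq]; exact h6.symm
    rw [s5] at b95; rw [s6] at b63
    exact ⟨(eq_of_testBit_ne (permWord_lt π 95) b95).1 rfl, (eq_of_testBit_ne (permWord_lt π 63) b63).2 rfl⟩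
  · right
    have s5 : π.symm 5 = 6 := by rw [Equiv.symm_apply_eq]; exact h6.symm
    have s6 : π.symm 6 = 5 := by rw [Equiv.symm_apply_eq]; exact h5.symm
    rw [s5] at b95; rw [s6] at b63
    exact ⟨(eq_of_testBit_ne (permWord_lt π 95) b95).2 rfl, (eq_of_testBit_ne (permWord_lt π 63) b63).1 rfl⟩

/-- **bit permutations fixing `{5, 6}` preserve word codes** -/
theorem IsWordCode.perm {W : Finset ℕ} (h : IsWordCode W) (π : Equiv.Perm (Fin 7)) (h56 : (π 5 = 5 ∧ π 6 = 6) ∨ (π 5 = 6 ∧ π 6 = 5)) :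
    IsWordCode (W.image (permWord π)) := by
  have hinj : Set.InjOn (permWord π) W := fun v hv w hw e => permWord_inj π (h.lt v hv) (h.lt w hw) e
  have fcard : ∀ (p : ℕ → Prop) [DecidablePred p], ((W.image (permWord π)).filter p).card = (W.filter fun w => p (permWord π w)).card := by
    intro p _
    rw [Finset.filter_image, Finset.card_image_of_injOn (fun v hv w hw e => hinj (Finset.mem_of_mem_filter v hv) (Finset.mem_of_mem_filter w hw) e)]
  have p9563 := permWord_95_63 π h56
  refine ⟨?_, ?_, ?_, ?_, ?_, fun x => ?_, ?_, ?_, ?_, fun x y hxy => ?_⟩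
  · rw [Finset.card_image_of_injOn hinj]; exact h.card_eq
  · intro w hw
    obtain ⟨v, -, rfl⟩ := Finset.mem_image.1 hw
    exact permWord_lt π v
  · exact Finset.mem_image.2 ⟨0, h.zero_mem, permWord_zero π⟩
  · rcases p9563 with ⟨e, -⟩ | ⟨-, e⟩
    · exact Finset.mem_image.2 ⟨95, h.w5_mem, e⟩
    · exact Finset.mem_image.2 ⟨63, h.w6_mem, e⟩
  · rcases p9563 with ⟨-, e⟩ | ⟨e, -⟩
    · exact Finset.mem_image.2 ⟨63, h.w6_mem, e⟩
    · exact Finset.mem_image.2 ⟨95, h.w5_mem, e⟩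
  · rw [fcard]
    simp only [testBit_permWord]
    exact h.balanced (π x)
  · intro v hv
    obtain ⟨u, hu, rfl⟩ := Finset.mem_image.1 hv
    rw [fcard]; simp only [hdist_permWord]; exact h.six u hu
  · intro v hv
    obtain ⟨u, hu, rfl⟩ := Finset.mem_image.1 hv
    rw [fcard]; simp only [hdist_permWord]; exact h.four u hu
  · intro v hv
    obtain ⟨u, hu, rfl⟩ := Finset.mem_image.1 hv
    rw [fcard]; simp only [hdist_permWord]; exact h.two u hu
  · rw [fcard]
    simp only [testBit_permWord]
    exact h.corr (π x) (π y) (π.injective.ne hxy)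

end FanoFive

end Summit.Ventures.DiscreteObjects.PP12
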